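import Summits.CriticalPhenomena.PercolationContinuityZ3.Theorems.PercNearOneGluingNoHeavyLowerTailAbsorptionMonotonicity
import Summits.CriticalPhenomena.PercolationContinuityZ3.Theorems.PercNearOneGluingNoHeavyLowerTailCILScaledReferenceTools
import HarnessLib

/-!
# `NoHeavyLowerTail` (stmt-CriticalPhenomena-4575) — gluing two observers: the witness's validity margin drops by at most
# `μ(N_u = 0, N_v ≥ 1)`

Support file (prover `prim-hp-3`, hull-port line; `--supports stmt-CriticalPhenomena-4575`).  No definitions, no named facts, no sorries.
Corollary of ABSORPTION MONOTONICITY (`HullPort.lightness_drop_le_of_glue`, file `…AbsorptionMonotonicity`).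

Notation: `μ_w = prodBernoulli w` on `Fin n`, relays `A`, level `j`, `N_y = |π(y)|` the number of relays joined to `y`, lightness
`I_w(y) = μ_w{N_y ≤ j}`, badness `bad_w(y) = μ_w{1 ≤ N_y ≤ j}`; a relay `c` is a VALID (cumulative-isolation) witness at the observer `y` when
`bad_w(y) ≤ I_w(c)`, with MARGIN `I_w(c) − bad_w(y)`.  For `u ≠ v` with `w s(u,v) = 0` let `w¹ = w[s(u,v) ↦ 1]` (the two vertices glued; in
`w¹` the vertex `u` IS the glued observer `u ⊕ v`).

**Theorem (`HullPort.glue_margin_ge`).**  If `I_w(v) ≤ I_w(u)` (`u` is the lighter of the two) then for every vertex `c`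

    `I_{w¹}(c) − bad_{w¹}(u)  ≥  I_w(c) − bad_w(u) − μ_w(N_u = 0 ∧ 1 ≤ N_v)`.

So a witness valid at the LIGHTER member `u` stays valid for the glued pair as soon as its margin at `u` covers the event "`u` sees no relay but
`v` does" (`HullPort.valid_glue_of_margin`).  Proof: absorption monotonicity gives `I_w(c) − I_{w¹}(c) ≤ I_w(u) − I_{w¹}(u)`; and
`bad = I − μ(N = 0)` in both graphs with `μ_{w¹}(N_u = 0) = μ_w(N_u = 0 ∧ N_v = 0)` (`ChampionStability.reachable_insert_left_iff`).

* `HullPort.lightness_margin_glue_ge_max` — hypothesis-free form for ANY two vertices `y ≠ z`: after gluing, every vertex's margin over the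
  merged vertex is at least its old margin over the LIGHTER-valued of the two: `I_{w¹}(q) − I_{w¹}(y ⊕ z) ≥ I_w(q) − max(I_w(y), I_w(z))`.  This is
  the termwise input of the "overtaking" bound `F ≥ D_{p*} − Ω` for the two-sided kernel (crux notes §9).

Context (crux notes HULLPORT-REF-gen2.md §8–§9; lead memo LEAD-GEN3 §7–§8): the k-uniform open core UNGLUE-CIL / MGR asks when a witness valid at
the members of a glued set of non-relays stays valid for the glued set; MGR with an arbitrary witness is false (prim-lf-8, `not_masterGluingRule`),
MGR with the champion has 0 violations.  This file gives the first HYPOTHESIS-LIGHT sufficient condition for the pair step (no separation, no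
domination of ports, any witness): margin at the lighter member ≥ `μ(N_u = 0, N_v ≥ 1)`.  Seat census (lab/gluecor.py, n = 7, exact): the bound
is an identity-level consequence of absorption monotonicity (0 / 3 516) and certifies 43 % of the champion instances of the pair step outright.
-/

noncomputable section

namespace Summit.CriticalPhenomena.PercolationContinuityZ3.Theorems

open MeasureTheory Set Literature.Probability.LatticeModels Literature.Probability.Percolation
open scoped Classical BigOperators

variable {n : ℕ}

namespace HullPort

open ChampionStability

/-- `μ{N_y ≤ j} = μ{N_y = 0} + μ{1 ≤ N_y ≤ j}` for any measure of the form `prodBernoulli u`. [folklore] -/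
theorem lightness_eq_zero_add_bad (u : Sym2 (Fin n) → unitInterval) (A : Finset (Fin n)) (y : Fin n) (j : ℕ) :
    (prodBernoulli u).real {ω : BondConfig (Fin n) | (A.filter fun z => ω ∈ openConn y z).card ≤ j} =
      (prodBernoulli u).real {ω : BondConfig (Fin n) | (A.filter fun z => ω ∈ openConn y z).card = 0} +
        (prodBernoulli u).real {ω : BondConfig (Fin n) |
          1 ≤ (A.filter fun z => ω ∈ openConn y z).card ∧ (A.filter fun z => ω ∈ openConn y z).card ≤ j} := by
  have hmeas : ∀ S : Set (BondConfig (Fin n)), MeasurableSet S := fun S => (Set.toFinite S).measurableSet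
  have hset : {ω : BondConfig (Fin n) | (A.filter fun z => ω ∈ openConn y z).card ≤ j} =
      {ω : BondConfig (Fin n) | (A.filter fun z => ω ∈ openConn y z).card = 0} ∪
        {ω : BondConfig (Fin n) |
          1 ≤ (A.filter fun z => ω ∈ openConn y z).card ∧ (A.filter fun z => ω ∈ openConn y z).card ≤ j} := by
    ext ω
    simp only [mem_setOf_eq, mem_union]
    constructor
    · intro h
      by_cases h0 : (A.filter fun z => ω ∈ openConn y z).card = 0
      · exact Or.inl h0
      · exact Or.inr ⟨Nat.one_le_iff_ne_zero.2 h0, h⟩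
    · rintro (h | ⟨_, h⟩)
      · rw [h]; exact Nat.zero_le _
      · exact h
  have hdisj : Disjoint {ω : BondConfig (Fin n) | (A.filter fun z => ω ∈ openConn y z).card = 0}
      {ω : BondConfig (Fin n) |
        1 ≤ (A.filter fun z => ω ∈ openConn y z).card ∧ (A.filter fun z => ω ∈ openConn y z).card ≤ j} := by
    rw [Set.disjoint_left]
    rintro ω (h0 : _ = 0) ⟨h1, _⟩
    rw [h0] at h1
    exact Nat.not_succ_le_zero 0 h1
  rw [hset, measureReal_union hdisj (hmeas _)]

/-- After gluing `u` to `v` (pair opened), `u` sees no relay iff neither `u` nor `v` saw one before. [folklore] -/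
theorem preimage_noRelay_glue (A : Finset (Fin n)) {u v : Fin n} (huv : u ≠ v) :
    (fun ω : BondConfig (Fin n) => insert s(u, v) ω) ⁻¹'
        {ω : BondConfig (Fin n) | (A.filter fun z => ω ∈ openConn u z).card = 0} =
      {ω : BondConfig (Fin n) | (A.filter fun z => ω ∈ openConn u z).card = 0 ∧
        (A.filter fun z => ω ∈ openConn v z).card = 0} := by
  ext ω
  simp only [mem_preimage, mem_setOf_eq, Finset.card_eq_zero, Finset.filter_eq_empty_iff]
  constructor
  · intro h
    refine ⟨fun z hz hr => h hz ?_, fun z hz hr => h hz ?_⟩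
    · exact (reachable_insert_left_iff ω huv z).2 (Or.inl hr)
    · exact (reachable_insert_left_iff ω huv z).2 (Or.inr hr)
  · rintro ⟨hu, hv⟩ z hz hr
    rcases (reachable_insert_left_iff ω huv z).1 hr with h | h
    · exact hu hz h
    · exact hv hz h

/-- **Gluing two observers costs the margin at the lighter one at most `μ(N_u = 0, N_v ≥ 1)`.**  Let `u ≠ v`, `w s(u,v) = 0`,
`I_w(v) ≤ I_w(u)`, and `w¹ = w[s(u,v) ↦ 1]`.  Then for every vertex `c`:
`I_{w¹}(c) − bad_{w¹}(u) ≥ I_w(c) − bad_w(u) − μ_w{N_u = 0 ∧ 1 ≤ N_v}`.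
[this file; from `HullPort.lightness_drop_le_of_glue`] -/
theorem glue_margin_ge (w : Sym2 (Fin n) → unitInterval) (A : Finset (Fin n)) (u v c : Fin n) (j : ℕ)
    (huv : u ≠ v) (hw : w s(u, v) = 0)
    (hle : (prodBernoulli w).real {ω : BondConfig (Fin n) | (A.filter fun z => ω ∈ openConn v z).card ≤ j} ≤
      (prodBernoulli w).real {ω : BondConfig (Fin n) | (A.filter fun z => ω ∈ openConn u z).card ≤ j}) :
    (prodBernoulli w).real {ω : BondConfig (Fin n) | (A.filter fun z => ω ∈ openConn c z).card ≤ j} -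
        (prodBernoulli w).real {ω : BondConfig (Fin n) |
          1 ≤ (A.filter fun z => ω ∈ openConn u z).card ∧ (A.filter fun z => ω ∈ openConn u z).card ≤ j} -
        (prodBernoulli w).real {ω : BondConfig (Fin n) |
          (A.filter fun z => ω ∈ openConn u z).card = 0 ∧ 1 ≤ (A.filter fun z => ω ∈ openConn v z).card} ≤
      (prodBernoulli (Function.update w s(u, v) 1)).real
          {ω : BondConfig (Fin n) | (A.filter fun z => ω ∈ openConn c z).card ≤ j} -
        (prodBernoulli (Function.update w s(u, v) 1)).real {ω : BondConfig (Fin n) |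
          1 ≤ (A.filter fun z => ω ∈ openConn u z).card ∧ (A.filter fun z => ω ∈ openConn u z).card ≤ j} := by
  have hmeas : ∀ S : Set (BondConfig (Fin n)), MeasurableSet S := fun S => (Set.toFinite S).measurableSet
  -- absorption monotonicity for the pair (u, v) and the third vertex c
  have habs := lightness_drop_le_of_glue w A u v c j huv hw hle
  -- bad = I − μ(N = 0) in both graphs
  have hsplit := lightness_eq_zero_add_bad w A u j
  have hsplit₁ := lightness_eq_zero_add_bad (Function.update w s(u, v) 1) A u j
  -- μ₁(N_u = 0) = μ(N_u = 0 ∧ N_v = 0)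
  have hzero : (prodBernoulli (Function.update w s(u, v) 1)).real
        {ω : BondConfig (Fin n) | (A.filter fun z => ω ∈ openConn u z).card = 0} =
      (prodBernoulli w).real {ω : BondConfig (Fin n) | (A.filter fun z => ω ∈ openConn u z).card = 0 ∧
        (A.filter fun z => ω ∈ openConn v z).card = 0} := by
    rw [real_update_one_eq w hw, preimage_noRelay_glue A huv]
  -- μ(N_u = 0) = μ(N_u = 0 ∧ N_v = 0) + μ(N_u = 0 ∧ 1 ≤ N_v)
  have hzsplit : (prodBernoulli w).real {ω : BondConfig (Fin n) | (A.filter fun z => ω ∈ openConn u z).card = 0} =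
      (prodBernoulli w).real {ω : BondConfig (Fin n) | (A.filter fun z => ω ∈ openConn u z).card = 0 ∧
          (A.filter fun z => ω ∈ openConn v z).card = 0} +
        (prodBernoulli w).real {ω : BondConfig (Fin n) |
          (A.filter fun z => ω ∈ openConn u z).card = 0 ∧ 1 ≤ (A.filter fun z => ω ∈ openConn v z).card} := by
    have hset : {ω : BondConfig (Fin n) | (A.filter fun z => ω ∈ openConn u z).card = 0} =
        {ω : BondConfig (Fin n) | (A.filter fun z => ω ∈ openConn u z).card = 0 ∧
            (A.filter fun z => ω ∈ openConn v z).card = 0} ∪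
          {ω : BondConfig (Fin n) |
            (A.filter fun z => ω ∈ openConn u z).card = 0 ∧ 1 ≤ (A.filter fun z => ω ∈ openConn v z).card} := by
      ext ω
      simp only [mem_setOf_eq, mem_union]
      constructor
      · intro h
        by_cases h0 : (A.filter fun z => ω ∈ openConn v z).card = 0
        · exact Or.inl ⟨h, h0⟩
        · exact Or.inr ⟨h, Nat.one_le_iff_ne_zero.2 h0⟩
      · rintro (⟨h, _⟩ | ⟨h, _⟩) <;> exact h
    have hdisj : Disjoint
        {ω : BondConfig (Fin n) | (A.filter fun z => ω ∈ openConn u z).card = 0 ∧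
            (A.filter fun z => ω ∈ openConn v z).card = 0}
        {ω : BondConfig (Fin n) |
          (A.filter fun z => ω ∈ openConn u z).card = 0 ∧ 1 ≤ (A.filter fun z => ω ∈ openConn v z).card} := by
      rw [Set.disjoint_left]
      rintro ω ⟨_, (h0 : _ = 0)⟩ ⟨_, h1⟩
      rw [h0] at h1
      exact Nat.not_succ_le_zero 0 h1
    rw [hset, measureReal_union hdisj (hmeas _)]
  linarith [habs, hsplit, hsplit₁, hzero, hzsplit]

/-- **Validity for the glued pair from a margin at the lighter member.**  Let `u ≠ v`, `w s(u,v) = 0`, `I_w(v) ≤ I_w(u)`, and let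
`c` be a vertex whose margin at `u` covers "`u` sees no relay but `v` does":
`bad_w(u) + μ_w{N_u = 0 ∧ 1 ≤ N_v} ≤ I_w(c)`.  Then `c` is a valid witness for the glued observer:
`bad_{w¹}(u) ≤ I_{w¹}(c)` in `w¹ = w[s(u,v) ↦ 1]`. [this file] -/
theorem valid_glue_of_margin (w : Sym2 (Fin n) → unitInterval) (A : Finset (Fin n)) (u v c : Fin n) (j : ℕ)
    (huv : u ≠ v) (hw : w s(u, v) = 0)
    (hle : (prodBernoulli w).real {ω : BondConfig (Fin n) | (A.filter fun z => ω ∈ openConn v z).card ≤ j} ≤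
      (prodBernoulli w).real {ω : BondConfig (Fin n) | (A.filter fun z => ω ∈ openConn u z).card ≤ j})
    (hmargin : (prodBernoulli w).real {ω : BondConfig (Fin n) |
          1 ≤ (A.filter fun z => ω ∈ openConn u z).card ∧ (A.filter fun z => ω ∈ openConn u z).card ≤ j} +
        (prodBernoulli w).real {ω : BondConfig (Fin n) |
          (A.filter fun z => ω ∈ openConn u z).card = 0 ∧ 1 ≤ (A.filter fun z => ω ∈ openConn v z).card} ≤
      (prodBernoulli w).real {ω : BondConfig (Fin n) | (A.filter fun z => ω ∈ openConn c z).card ≤ j}) :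
    (prodBernoulli (Function.update w s(u, v) 1)).real {ω : BondConfig (Fin n) |
          1 ≤ (A.filter fun z => ω ∈ openConn u z).card ∧ (A.filter fun z => ω ∈ openConn u z).card ≤ j} ≤
      (prodBernoulli (Function.update w s(u, v) 1)).real
          {ω : BondConfig (Fin n) | (A.filter fun z => ω ∈ openConn c z).card ≤ j} := by
  have h := glue_margin_ge w A u v c j huv hw hle
  linarith

/-- **Margin over a merged vertex, hypothesis-free.**  Let `y ≠ z`, `w s(y,z) = 0`, `w¹ = w[s(y,z) ↦ 1]`.  Then for every vertex `q`:
`I_w(q) − max(I_w(y), I_w(z)) ≤ I_{w¹}(q) − I_{w¹}(y)` (and `I_{w¹}(y) = I_{w¹}(z)` is the lightness of the merged vertex): whichever of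
`y, z` is lighter absorbs the other, and absorption monotonicity applies. [this file] -/
theorem lightness_margin_glue_ge_max (w : Sym2 (Fin n) → unitInterval) (A : Finset (Fin n)) (y z q : Fin n) (j : ℕ)
    (hyz : y ≠ z) (hw : w s(y, z) = 0) :
    (prodBernoulli w).real {ω : BondConfig (Fin n) | (A.filter fun x => ω ∈ openConn q x).card ≤ j} -
        max ((prodBernoulli w).real {ω : BondConfig (Fin n) | (A.filter fun x => ω ∈ openConn y x).card ≤ j})
          ((prodBernoulli w).real {ω : BondConfig (Fin n) | (A.filter fun x => ω ∈ openConn z x).card ≤ j}) ≤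
      (prodBernoulli (Function.update w s(y, z) 1)).real
          {ω : BondConfig (Fin n) | (A.filter fun x => ω ∈ openConn q x).card ≤ j} -
        (prodBernoulli (Function.update w s(y, z) 1)).real
          {ω : BondConfig (Fin n) | (A.filter fun x => ω ∈ openConn y x).card ≤ j} := by
  by_cases h : (prodBernoulli w).real {ω : BondConfig (Fin n) | (A.filter fun x => ω ∈ openConn z x).card ≤ j} ≤
      (prodBernoulli w).real {ω : BondConfig (Fin n) | (A.filter fun x => ω ∈ openConn y x).card ≤ j}
  · rw [max_eq_left h]
    exact lightness_margin_le_glue w A y z q j hyz hw h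
  · have h' : (prodBernoulli w).real {ω : BondConfig (Fin n) | (A.filter fun x => ω ∈ openConn y x).card ≤ j} ≤
        (prodBernoulli w).real {ω : BondConfig (Fin n) | (A.filter fun x => ω ∈ openConn z x).card ≤ j} := le_of_lt (not_le.1 h)
    rw [max_eq_right h']
    have he : s(z, y) = s(y, z) := Sym2.eq_swap
    have hw' : w s(z, y) = 0 := by rw [he]; exact hw
    have h1 := lightness_margin_le_glue w A z y q j hyz.symm hw' h'
    rw [he] at h1
    have hsame := lightness_eq_of_weight_one (Function.update w s(y, z) 1) A hyz j (Function.update_self _ _ _)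
    rw [hsame]
    exact h1

end HullPort

end Summit.CriticalPhenomena.PercolationContinuityZ3.Theorems

end
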